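import Literature.Barriers.AtomisticToContinuum.AnticontinuumLocalizationGeometry4
import Literature.Barriers.AtomisticToContinuum.AnticontinuumLocalizationAssembly
import Literature.Barriers.AtomisticToContinuum.AnticontinuumLocalizationThm1Reduction
import Literature.Barriers.AtomisticToContinuum.AnticontinuumLocalizationDecorrelation
import HarnessLib

/-!
# De Roeck–Huveneers 2015: Theorem 1 for large chains and the proof of Theorem 2

`Literature/Barriers/AtomisticToContinuum/` — the last step of the formalisation of W. De Roeck,
F. Huveneers, *Asymptotic localization of energy in nondisordered oscillator chains*, CPAM 68
(2015), arXiv:1305.5127, for the rotor chain: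

* `windowSolutions_with_room`: §§3–5 assembled — for `γ`, `T > 0`, `n₀` there are `M`, `m₀` such
  that EVERY window with at least `m₀` sites carries window solutions `(U, G)` (§5.2) with the
  bounds of §5.6 (the cut-offs of §4 from `…Geometry4`, the scheme of §3 and the bounds of §5 from
  `…Assembly`; the room `m ≥ m₀` is what the proof of Lemma 4 needs: `n₂` well separated sites);
* `DeRoeckHuveneers2015_thm1_largeN`: hence the conclusion of Theorem 1 for all odd `N ≥ N₀`
  (the printed proof is an infinite-volume argument: its Lemma 4 uses `n₂(γ… )` separated sites, so
  it yields Theorem 1 for `N ≥ N₀(γ, T, n)`; the vendored `DeRoeckHuveneers2015_thm1` also covers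
  small `N`, which the source does not address — recorded, not claimed);
* **`DeRoeckHuveneers2015_thm2_holds : DeRoeckHuveneers2015_thm2`** — Theorem 2 (the `N → ∞`
  statement) by the printed §7 argument from the large-`N` Theorem 1, stationarity and the
  decorrelation inequality of §7 (`DeRoeckHuveneers2015_decorrelation`).

All proved; no named facts.
-/

noncomputable section

open MeasureTheory ProbabilityTheory Function Set Filter Metric
open scoped BigOperators Topology ENNReal NNReal ContDiff

namespace Literature.Barriers.AtomisticToContinuum

namespace HeatConduction.RotorChain

open Literature.MathematicalPhysics.KineticTheory.HeatConduction Literature.Analysis.Calculus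

variable {m : ℕ}

/-! ### Room in large windows -/

/-- **Large windows have room**: if `2 n₂ (2R+1) ≤ n₃ < m` then `B(b, n₃)` contains `n₂` sites
pairwise more than `2R` apart. [cite: DeRoeckHuveneers2015, §5.5 proof of Lemma 4 ("By taking `n₃` large enough")] -/
theorem hasRoom_of_large {R n₂ n₃ : ℕ} (h1 : 2 * n₂ * (2 * R + 1) ≤ n₃) (h2 : n₃ < m) (b : Fin m) : HasRoom R n₂ b n₃ := by
  set s : ℕ := 2 * R + 1 with hs
  have hs1 : 2 * R < s := by omega
  have h1' : n₂ * s + n₂ * s ≤ n₃ := by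
    have e : n₂ * s + n₂ * s = 2 * n₂ * (2 * R + 1) := by rw [hs]; ring
    rw [e]; exact h1
  -- the offsets `d j = (j+1) s`, pairwise `≥ s` apart and `≤ n₂ s`
  set d : Fin n₂ → ℕ := fun j => (j.val + 1) * s with hd
  have hdle : ∀ j : Fin n₂, d j ≤ n₂ * s := fun j => Nat.mul_le_mul_right _ j.isLt
  have hdpos : ∀ j : Fin n₂, s ≤ d j := fun j => by
    show s ≤ (j.val + 1) * s
    nlinarith
  have hdsep : ∀ i j : Fin n₂, i ≠ j → d i + s ≤ d j ∨ d j + s ≤ d i := by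
    intro i j hij
    have hne : i.val ≠ j.val := fun h => hij (Fin.ext h)
    show (i.val + 1) * s + s ≤ (j.val + 1) * s ∨ (j.val + 1) * s + s ≤ (i.val + 1) * s
    rcases Nat.lt_or_gt_of_ne hne with hlt | hlt
    · left
      have : (i.val + 1 + 1) * s ≤ (j.val + 1) * s := Nat.mul_le_mul_right _ (by omega)
      nlinarith
    · right
      have : (j.val + 1 + 1) * s ≤ (i.val + 1) * s := Nat.mul_le_mul_right _ (by omega)
      nlinarith
  by_cases hb : n₂ * s ≤ b.val
  · -- room to the left of `b`
    refine ⟨fun j => ⟨b.val - d j, lt_of_le_of_lt (Nat.sub_le _ _) b.isLt⟩, fun j => ?_, fun i j hij => ?_⟩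
    · rw [mem_nearSites]
      have := hdle j
      simp only [Nat.dist]
      omega
    · have hi := hdle i; have hj := hdle j
      rcases hdsep i j hij with h | h <;> simp only [Nat.dist] <;> omega
  · -- room to the right of `b`
    push Not at hb
    refine ⟨fun j => ⟨b.val + d j, by have := hdle j; omega⟩, fun j => ?_, fun i j hij => ?_⟩
    · rw [mem_nearSites]
      have := hdle j
      simp only [Nat.dist]
      omega
    · have hi := hdle i; have hj := hdle j
      rcases hdsep i j hij with h | h <;> simp only [Nat.dist] <;> omega

/-- Windows are not too small: `min N (M + 2) ≤ windowSize a M`. [folklore] -/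
theorem min_le_windowSize {N : ℕ} (a : Fin N) (M : ℕ) : min N (M + 2) ≤ windowSize a M := by
  have ha := a.isLt
  unfold windowSize windowHi windowLo
  rcases le_total (N - 1) (a.val + (M + 1)) with h | h
  · rw [min_eq_left h]; omega
  · rw [min_eq_right h]; omega


/-- Window solutions stay window solutions for a larger locality radius. [folklore] -/
theorem IsWindowSolution.mono_radius {m : ℕ} {b : Fin m} {γ T ε : ℝ} {n M M' : ℕ} {C : ℝ}
    {U G : PhaseSpace m → ℝ} (h : IsWindowSolution m b γ T ε n M C U G) (hMM' : M ≤ M') :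
    IsWindowSolution m b γ T ε n M' C U G := by
  obtain ⟨h1, h2, h3, h4, h5, h6, h7, h8, h9, h10, h11⟩ := h
  exact ⟨h1, h2, h3, h4, h5.mono (by exact_mod_cast hMM'), h6.mono (by exact_mod_cast hMM'), h7, h8, h9, h10, h11⟩

/-! ### §§3–5 assembled: window solutions for all large windows -/

/-- **Window solutions with room** (§§3–5 of the paper): for `γ`, `T > 0` and `n₀` there are a
locality radius `M` and a size `m₀ ≤ M + 2` such that every window `(m, b)` with `m ≥ m₀` admits,
for all `ε ∈ (0, 1)`, window solutions `(U, G)` of `ε J_{a,a+1} = L_H U + ε^{n₀+1} G` with the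
bounds of §5.6. [cite: DeRoeckHuveneers2015, §3 (scheme), §4.2 Prop. 2 (cut-offs), §5.2 (definition of `U_a`, `G_a`) and §5.3–5.6 (locality, bounds)] -/
theorem windowSolutions_with_room (γ : ℝ) {T : ℝ} (hT : 0 < T) (n₀ : ℕ) :
    ∃ M m₀ : ℕ, m₀ ≤ M + 2 ∧ ∀ m : ℕ, m₀ ≤ m → ∀ b : Fin m, ∃ C ε₀ : ℝ, 0 < ε₀ ∧ ∀ ε : ℝ, 0 < ε → ε < ε₀ →
      ∃ U G : PhaseSpace m → ℝ, IsWindowSolution m b γ T ε n₀ M C U G := by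
  -- the parameters of §§3–5
  set n : ℕ := 2 * n₀ + 1 with hn
  set r : ℕ := max (stageModeBound n n) (stageRad n n) with hr
  have hsr : IsSchemeRadius n r := ⟨le_max_left _ _, le_max_right _ _⟩
  set n₂ : ℕ := 8 * n₀ + 12 with hn₂
  have hn₂1 : 1 ≤ n₂ := by omega
  set R : ℕ := clusterRad r n₂ with hR
  set n₃ : ℕ := 2 * n₂ * (2 * R + 1) with hn₃
  set M : ℕ := max (locRad n n₃ R) n₃ with hM
  refine ⟨M, n₃ + 1, by omega, fun m hm b => ?_⟩
  -- the cut-offs of §4 on the window and the assembled solution of §5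
  let Θ : ResonanceCutoffs m r (cutoffL m r) n₂ := resonanceCutoffs m r n₂ hn₂1
  have hRS : Θ.RS = R := rfl
  have hRθ : Θ.Rθ = R := rfl
  have hroom : HasRoom Θ.RS n₂ b n₃ := by rw [hRS]; exact hasRoom_of_large le_rfl (by omega) b
  obtain ⟨C, hC⟩ := windowSolution_of_cutoffs Θ b n₃ γ hT n₀ hsr le_rfl hroom
  refine ⟨C, 1, one_pos, fun ε hε hε1 => ?_⟩
  have h := hC ε hε hε1
  rw [hRθ] at h
  exact ⟨_, _, h.mono_radius (le_max_left _ _)⟩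

/-! ### Theorem 1 for large chains -/

/-- Window solutions for all large windows, with constants `C ≥ M`, `C ≥ 0`, `ε₀ > 0` made uniform
over the finitely many windows of `m₀ ≤ m ≤ 2M + 3` sites (a finite maximum / minimum). [folklore] -/
theorem windowSolutions_uniform_with_room {γ T : ℝ} {n : ℕ}
    (h : ∃ M m₀ : ℕ, m₀ ≤ M + 2 ∧ ∀ m : ℕ, m₀ ≤ m → ∀ b : Fin m, ∃ C ε₀ : ℝ, 0 < ε₀ ∧ ∀ ε : ℝ, 0 < ε → ε < ε₀ →
      ∃ U G : PhaseSpace m → ℝ, IsWindowSolution m b γ T ε n M C U G) :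
    ∃ M m₀ : ℕ, m₀ ≤ M + 2 ∧ ∃ C ε₀ : ℝ, 0 ≤ C ∧ (M : ℝ) ≤ C ∧ 0 < ε₀ ∧
      ∀ m : ℕ, m₀ ≤ m → m ≤ 2 * M + 3 → ∀ b : Fin m, ∀ ε : ℝ, 0 < ε → ε < ε₀ →
        ∃ U G : PhaseSpace m → ℝ, IsWindowSolution m b γ T ε n M C U G := by
  classical
  obtain ⟨M, m₀, hm₀, hM⟩ := h
  have hM' : ∀ p : {p : Σ m : ℕ, Fin m // m₀ ≤ p.1}, ∃ C ε₀ : ℝ, 0 < ε₀ ∧ ∀ ε : ℝ, 0 < ε → ε < ε₀ →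
      ∃ U G : PhaseSpace p.1.1 → ℝ, IsWindowSolution p.1.1 p.1.2 γ T ε n M C U G := fun p => hM p.1.1 p.2 p.1.2
  choose Cf ε₀f hε₀f hmain using hM'
  let S : Finset (Σ m : ℕ, Fin m) := ((Finset.range (2 * M + 4)).sigma fun _ => Finset.univ).filter fun p => m₀ ≤ p.1
  have hm₀pos : 0 < M + 2 := by omega
  have hS : S.Nonempty := ⟨⟨M + 2, ⟨0, hm₀pos⟩⟩, by simp [S]; omega⟩
  let S' : Finset {p : Σ m : ℕ, Fin m // m₀ ≤ p.1} := S.subtype fun p => m₀ ≤ p.1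
  have hS' : S'.Nonempty := by
    obtain ⟨p, hp⟩ := hS
    have hp' : m₀ ≤ p.1 := (Finset.mem_filter.1 hp).2
    exact ⟨⟨p, hp'⟩, Finset.mem_subtype.2 hp⟩
  set Cs : ℝ := S'.sup' hS' fun p => Cf p with hCs
  set εs : ℝ := S'.inf' hS' fun p => ε₀f p with hεs
  refine ⟨M, m₀, hm₀, max (max Cs 0) M, εs, le_trans (le_max_right _ _) (le_max_left _ _), le_max_right _ _,
    (Finset.lt_inf'_iff hS').2 fun p _ => hε₀f p, ?_⟩
  intro m hm hm' b ε hε hεε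
  have hp : (⟨m, b⟩ : Σ m : ℕ, Fin m) ∈ S := by
    simp only [S, Finset.mem_filter, Finset.mem_sigma, Finset.mem_range, Finset.mem_univ, and_true]
    omega
  have hp' : (⟨⟨m, b⟩, hm⟩ : {p : Σ m : ℕ, Fin m // m₀ ≤ p.1}) ∈ S' := Finset.mem_subtype.2 hp
  have hC : Cf ⟨⟨m, b⟩, hm⟩ ≤ max (max Cs 0) M :=
    le_trans (le_trans (Finset.le_sup' (fun p : {p : Σ m : ℕ, Fin m // m₀ ≤ p.1} => Cf p) hp') (le_max_left _ _))
      (le_max_left _ _)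
  have hε₀ : εs ≤ ε₀f ⟨⟨m, b⟩, hm⟩ := Finset.inf'_le (fun p : {p : Σ m : ℕ, Fin m // m₀ ≤ p.1} => ε₀f p) hp'
  obtain ⟨U, G, hUG⟩ := hmain ⟨⟨m, b⟩, hm⟩ ε hε (lt_of_lt_of_le hεε hε₀)
  exact ⟨U, G, hUG.mono hε.le hC⟩


end HeatConduction.RotorChain

open Literature.MathematicalPhysics.KineticTheory.HeatConduction HeatConduction HeatConduction.RotorChain

/-- **Theorem 1 of De Roeck–Huveneers for all large chains**: for `γ ≥ 0`, `T > 0` and every `n` there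
are `N₀`, `C`, `ε₀ > 0` such that for `0 < ε < ε₀`, every odd `N ≥ N₀` and every site `a` the current
decomposes as `ε J_{a,a+1} = L_H U_a + ε^{n+1} G_a` with smooth, periodic, `C`-local, centred
`U_a, G_a` obeying `⟨U_a²⟩_T ≤ Cε^{1/4}`, `⟨(∂U_a)²⟩_T ≤ Cε^{-1/4}`, `⟨G_a²⟩_T, ⟨(∂G_a)²⟩_T ≤ C`
— the printed Theorem 1, whose proof (§§3–5: its Lemma 4 needs `n₂` well separated sites near `a`)
is an argument for large `N`; transplanted from the window solutions exactly as in
`DeRoeckHuveneers2015_thm1_of_windowSolutions`. [cite: DeRoeckHuveneers2015, §2.3 Thm 1, §§3–5] -/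
theorem DeRoeckHuveneers2015_thm1_largeN (γ : ℝ) (hγ : 0 ≤ γ) (T : ℝ) (hT : 0 < T) (n : ℕ) :
    ∃ N₀ : ℕ, ∃ C : ℝ, ∃ ε₀ : ℝ, 0 ≤ C ∧ 0 < ε₀ ∧ ∀ ε : ℝ, 0 < ε → ε < ε₀ →
      ∀ N : ℕ, N₀ ≤ N → Odd N → ∀ a : Fin N,
        ∃ U G : PhaseSpace N → ℝ,
          ContDiff ℝ ∞ U ∧ ContDiff ℝ ∞ G ∧ IsAnglePeriodic N U ∧ IsAnglePeriodic N G ∧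
          DependsOnlyNear N a C U ∧ DependsOnlyNear N a C G ∧
          Integrable U (gibbsMeasure N T ε γ) ∧ Integrable G (gibbsMeasure N T ε γ) ∧
          ∫ z, U z ∂(gibbsMeasure N T ε γ) = 0 ∧ ∫ z, G z ∂(gibbsMeasure N T ε γ) = 0 ∧
          (∀ z : PhaseSpace N,
            ε * bondCurrent N a z = liouville N ε γ U z + ε ^ (n + 1) * G z) ∧
          Integrable (fun z => U z ^ 2) (gibbsMeasure N T ε γ) ∧
          ∫ z, U z ^ 2 ∂(gibbsMeasure N T ε γ) ≤ C * ε ^ (1 / 4 : ℝ) ∧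
          Integrable (fun z => G z ^ 2) (gibbsMeasure N T ε γ) ∧
          ∫ z, G z ^ 2 ∂(gibbsMeasure N T ε γ) ≤ C ∧
          ∀ x : Fin N,
            Integrable (fun z => partialQ x U z ^ 2) (gibbsMeasure N T ε γ) ∧
            ∫ z, partialQ x U z ^ 2 ∂(gibbsMeasure N T ε γ) ≤ C * ε ^ (-(1 / 4) : ℝ) ∧
            Integrable (fun z => partialP x U z ^ 2) (gibbsMeasure N T ε γ) ∧
            ∫ z, partialP x U z ^ 2 ∂(gibbsMeasure N T ε γ) ≤ C * ε ^ (-(1 / 4) : ℝ) ∧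
            Integrable (fun z => partialQ x G z ^ 2) (gibbsMeasure N T ε γ) ∧
            ∫ z, partialQ x G z ^ 2 ∂(gibbsMeasure N T ε γ) ≤ C ∧
            Integrable (fun z => partialP x G z ^ 2) (gibbsMeasure N T ε γ) ∧
            ∫ z, partialP x G z ^ 2 ∂(gibbsMeasure N T ε γ) ≤ C := by
  obtain ⟨M, m₀, hm₀, C, ε₀, hC0, hMC, hε₀, hmain⟩ := windowSolutions_uniform_with_room (windowSolutions_with_room γ hT n)
  refine ⟨M + 2, C, ε₀, hC0, hε₀, fun ε hε hεε N hN _hodd a => ?_⟩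
  -- the window around `a` (of size `≥ min N (M+2) ≥ m₀`) and its objects
  have hsize : m₀ ≤ windowSize a M := le_trans (by omega) (le_trans (le_min hN le_rfl) (min_le_windowSize a M))
  obtain ⟨U, G, hUs, hGs, hUp, hGp, hUl, hGl, hid, ⟨u₀, hu₀m, hU0, hbu₀⟩, ⟨u₁, hu₁m, hU1, hbu₁⟩,
    ⟨g₀, hg₀m, hG0, hbg₀⟩, ⟨g₁, hg₁m, hG1, hbg₁⟩⟩ :=
    hmain (windowSize a M) hsize (windowSize_le a M) (windowBond a M) ε hε hεε
  haveI := isProbabilityMeasure_gibbsMeasure hT N ε γ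
  have hε4 : 0 ≤ C * ε ^ (1 / 4 : ℝ) := by positivity
  have hε4' : 0 ≤ C * ε ^ (-(1 / 4) : ℝ) := by positivity
  -- the transplanted `U`
  set V : PhaseSpace N → ℝ := U ∘ windowProj a M with hV
  have hVs : ContDiff ℝ ∞ V := contDiff_comp_windowProj a M hUs
  have hVs1 : ContDiff ℝ 1 V := hVs.of_le (by exact_mod_cast le_top)
  have hVc : Continuous V := hVs.continuous
  have hVp : IsAnglePeriodic N V := isAnglePeriodic_comp_windowProj a M hUp
  have hVl : DependsOnlyNear N a M V := dependsOnlyNear_comp_windowProj a M hUl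
  have hV2 := sq_bound_of_window_majorant hT hε.le hγ a M hVc.aestronglyMeasurable hu₀m
    (fun z => hU0 (windowProj a M z)) hε4 hbu₀
  obtain ⟨hVi, hW2i, hWmean, hWle⟩ := integral_sq_sub_average_le hVc.aestronglyMeasurable hV2.1
  set c : ℝ := ∫ w, V w ∂(gibbsMeasure N T ε γ) with hc
  -- the transplanted `G`
  set GN : PhaseSpace N → ℝ := G ∘ windowProj a M with hGN
  have hGNs : ContDiff ℝ ∞ GN := contDiff_comp_windowProj a M hGs
  have hGNs1 : ContDiff ℝ 1 GN := hGNs.of_le (by exact_mod_cast le_top)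
  have hGNc : Continuous GN := hGNs.continuous
  have hGN2 := sq_bound_of_window_majorant hT hε.le hγ a M hGNc.aestronglyMeasurable hg₀m
    (fun z => hG0 (windowProj a M z)) hC0 hbg₀
  obtain ⟨hGNi, -, -, -⟩ := integral_sq_sub_average_le hGNc.aestronglyMeasurable hGN2.1
  -- majorants of the coordinate derivatives of the transplants
  have hderQ : ∀ (F : PhaseSpace (windowSize a M) → ℝ) (u : (Fin (windowSize a M) → ℝ) → ℝ≥0∞),
      (∀ (w : PhaseSpace (windowSize a M)) (i : Fin (windowSize a M)), ‖partialQ i F w‖ₑ ≤ u w.2) →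
      ∀ (x : Fin N) (z : PhaseSpace N),
        ‖partialQ x (F ∘ windowProj a M) z‖ₑ ≤ u (windowProj a M z).2 := by
    intro F u hu x z
    by_cases hx : ∃ i, windowEmb a M i = x
    · obtain ⟨i, rfl⟩ := hx
      rw [partialQ_comp_windowProj]
      exact hu _ i
    · push Not at hx
      rw [partialQ_comp_windowProj_eq_zero a M F z hx]
      simp
  have hderP : ∀ (F : PhaseSpace (windowSize a M) → ℝ) (u : (Fin (windowSize a M) → ℝ) → ℝ≥0∞),
      (∀ (w : PhaseSpace (windowSize a M)) (i : Fin (windowSize a M)), ‖partialP i F w‖ₑ ≤ u w.2) →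
      ∀ (x : Fin N) (z : PhaseSpace N),
        ‖partialP x (F ∘ windowProj a M) z‖ₑ ≤ u (windowProj a M z).2 := by
    intro F u hu x z
    by_cases hx : ∃ i, windowEmb a M i = x
    · obtain ⟨i, rfl⟩ := hx
      rw [partialP_comp_windowProj]
      exact hu _ i
    · push Not at hx
      rw [partialP_comp_windowProj_eq_zero a M F z hx]
      simp
  -- the identity on the chain
  have hidN : ∀ z : PhaseSpace N,
      ε * bondCurrent N a z = liouville N ε γ (fun w => V w - c) z + ε ^ (n + 1) * GN z := by
    intro z
    rw [liouville_sub_const, hV, liouville_comp_windowProj a M hUl, bondCurrent_windowEmb a M z, hGN,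
      comp_apply]
    exact hid (windowProj a M z)
  -- `⟨G_a⟩_T = 0`
  have hJi := integrable_bondCurrent (N := N) hT hε.le hγ a
  have hUNi : Integrable (fun w => V w - c) (gibbsMeasure N T ε γ) := hVi.sub (integrable_const c)
  have hLeq : liouville N ε γ (fun w => V w - c) =
      fun z => ε * bondCurrent N a z - ε ^ (n + 1) * GN z := by
    funext z; have := hidN z; linarith
  have hLi : Integrable (liouville N ε γ (fun w => V w - c)) (gibbsMeasure N T ε γ) := by
    rw [hLeq]; exact (hJi.const_mul ε).sub (hGNi.const_mul _)
  have hL0 := integral_liouville_eq_zero T ε γ (hVs1.sub contDiff_const) (hVp.sub_const c) hUNi hLi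
  have hGmean : ∫ z, GN z ∂(gibbsMeasure N T ε γ) = 0 := by
    rw [hLeq, integral_sub (hJi.const_mul ε) (hGNi.const_mul _), integral_const_mul, integral_const_mul,
      integral_bondCurrent hT hε.le hγ a, mul_zero, zero_sub, neg_eq_zero, mul_eq_zero] at hL0
    exact hL0.resolve_left (pow_ne_zero _ hε.ne')
  refine ⟨fun w => V w - c, GN, hVs.sub contDiff_const, hGNs, hVp.sub_const c,
    isAnglePeriodic_comp_windowProj a M hGp, (hVl.mono hMC).sub_const c,
    (dependsOnlyNear_comp_windowProj a M hGl).mono hMC, hUNi, hGNi, hWmean, hGmean, hidN, hW2i,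
    hWle.trans hV2.2, hGN2.1, hGN2.2, fun x => ?_⟩
  -- the eight derivative bounds at site `x`
  have hQU := sq_bound_of_window_majorant hT hε.le hγ a M
    (continuous_partialQ hVs1 one_ne_zero x).aestronglyMeasurable hu₁m
    (hderQ U u₁ (fun w i => (hU1 w i).1) x) hε4' hbu₁
  have hPU := sq_bound_of_window_majorant hT hε.le hγ a M
    (continuous_partialP hVs1 one_ne_zero x).aestronglyMeasurable hu₁m
    (hderP U u₁ (fun w i => (hU1 w i).2) x) hε4' hbu₁
  have hQG := sq_bound_of_window_majorant hT hε.le hγ a M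
    (continuous_partialQ hGNs1 one_ne_zero x).aestronglyMeasurable hg₁m
    (hderQ G g₁ (fun w i => (hG1 w i).1) x) hC0 hbg₁
  have hPG := sq_bound_of_window_majorant hT hε.le hγ a M
    (continuous_partialP hGNs1 one_ne_zero x).aestronglyMeasurable hg₁m
    (hderP G g₁ (fun w i => (hG1 w i).2) x) hC0 hbg₁
  simp only [partialQ_sub_const, partialP_sub_const]
  exact ⟨hQU.1, hQU.2, hPU.1, hPU.2, hQG.1, hQG.2, hPG.1, hPG.2⟩


/-! ### Theorem 2 -/

/-- **De Roeck–Huveneers 2015, Theorem 2 for the rotor chain — proved.** The finite-time Green–Kubo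
conductivity is `o(ε^m)` on every time scale `ε^{-n}t`, `1 ≤ m < n`, in the order of limits
`N → ∞`, `ε → 0`, `t → ∞`: the printed §7 argument (`DeRoeckHuveneers2015_thm2_of_thm1`, verbatim
but fed with Theorem 1 for `N ≥ N₀`, which is all the `limsup_{N → ∞}` sees), with stationarity
(`GibbsStationarity_holds`) and the decorrelation inequality of §7
(`DeRoeckHuveneers2015_decorrelation_holds`). [cite: DeRoeckHuveneers2015, §2.3 Thm 2 and §7 (proof of Theorems 2, 3 and 4)] -/
theorem DeRoeckHuveneers2015_thm2_holds : DeRoeckHuveneers2015_thm2 := by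
  have hS : GibbsStationarity := GibbsStationarity_holds
  have hD : DeRoeckHuveneers2015_decorrelation := DeRoeckHuveneers2015_decorrelation_holds
  intro γ hγ T hT n m hm hmn Φ hΦ
  obtain ⟨N₀, C, ε₀, hC0, hε₀, hthm1⟩ := DeRoeckHuveneers2015_thm1_largeN γ hγ T hT n
  obtain ⟨Cd, c, ε₁, hc, hε₁, hdec⟩ := hD γ hγ T hT
  -- it suffices to show that the double `limsup` vanishes for every `t > 0`
  suffices key : ∀ t : ℝ, 0 < t →
      limsup (fun ε : ℝ => limsup (fun N : ℕ => finiteTimeConductivity γ T ε n m N (Φ ε N) t)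
        (atTop ⊓ 𝓟 {N | Odd N})) (𝓝[>] 0) = 0 by
    refine tendsto_const_nhds.congr' ?_
    filter_upwards [eventually_gt_atTop 0] with t ht
    exact (key t ht).symm
  intro t ht
  obtain ⟨d, hd⟩ : ∃ d, n = m + 1 + d := ⟨n - m - 1, by omega⟩
  set S : ℝ := ∑' k : ℤ, Real.exp (-c * |(k : ℝ)|) with hS'
  set K₁ : ℝ := |Cd| * Real.exp (2 * c * C) * (Real.exp (c * C) * S * (2 * C)) * S with hK₁
  have hS0 : 0 ≤ S := tsum_nonneg fun k => (Real.exp_pos _).le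
  have hK₁0 : 0 ≤ K₁ := by positivity
  -- the bound at fixed small `ε`, uniform in odd `N`
  set B : ℝ → ℝ := fun ε => ε ^ (-(m : ℝ)) / T ^ 2 * (3 / (ε ^ (-(n : ℝ)) * t) *
    (2 * (K₁ * ε ^ (-(1 / 4 : ℝ))) + (ε ^ (n + 1)) ^ 2 * (ε ^ (-(n : ℝ)) * t) ^ 2 * K₁)) with hB
  have hbound : ∀ ε, 0 < ε → ε < min ε₀ ε₁ → ∀ N, N₀ ≤ N → Odd N →
      finiteTimeConductivity γ T ε n m N (Φ ε N) t ≤ ENNReal.ofReal (B ε) := by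
    intro ε hε hε' N hN₀ hN
    have hεε₀ : ε < ε₀ := hε'.trans_le (min_le_left _ _)
    have hεε₁ : ε < ε₁ := hε'.trans_le (min_le_right _ _)
    choose U G hUs hGs hUp hGp hUl hGl hUi hGi hU0 hG0 hid hU2i hU2b hG2i hG2b hpart using
      hthm1 ε hε hεε₀ N hN₀ hN
    set μ := gibbsMeasure N T ε γ with hμ
    have hNpos : (0 : ℝ) < N := by exact_mod_cast hN.pos
    have hUm : ∀ a, MemLp (U a) 2 μ := fun a =>
      (memLp_two_iff_integrable_sq ((hUs a).continuous.aestronglyMeasurable)).2 (hU2i a)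
    have hGm : ∀ a, MemLp (G a) 2 μ := fun a =>
      (memLp_two_iff_integrable_sq ((hGs a).continuous.aestronglyMeasurable)).2 (hG2i a)
    -- Dirichlet-form bounds from the locality and the bounds of Theorem 1
    have hgU : ∀ a, gradSqNorm μ (U a) ≤ Real.exp (c * C) * S * (2 * (C * ε ^ (-(1 / 4 : ℝ)))) :=
      fun a => gradSqNorm_le μ (by positivity) hc (hUl a)
        fun x => ⟨(hpart a x).2.1, (hpart a x).2.2.2.1⟩
    have hgG : ∀ a, gradSqNorm μ (G a) ≤ Real.exp (c * C) * S * (2 * C) :=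
      fun a => gradSqNorm_le μ hC0 hc (hGl a)
        fun x => ⟨(hpart a x).2.2.2.2.2.1, (hpart a x).2.2.2.2.2.2.2⟩
    -- covariance bounds from the decorrelation inequality
    have hcovU : ∀ a b : Fin N, |∫ z, U a z * U b z ∂μ| ≤
        |Cd| * Real.exp (-c * (|(a.val : ℝ) - b.val| - C - C)) *
          Real.sqrt (gradSqNorm μ (U a)) * Real.sqrt (gradSqNorm μ (U b)) := by
      intro a b
      refine (hdec ε hε hεε₁ N hN (U a) (U b) a b C C (hUs a) (hUs b) (hUp a) (hUp b) (hUl a)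
        (hUl b) (hU2i a) (hU2i b) (fun x => ⟨(hpart a x).1, (hpart a x).2.2.1⟩)
        (fun x => ⟨(hpart b x).1, (hpart b x).2.2.1⟩) (hU0 a) (hU0 b)).trans ?_
      gcongr
      exact le_abs_self Cd
    have hcovG : ∀ a b : Fin N, |∫ z, G a z * G b z ∂μ| ≤
        |Cd| * Real.exp (-c * (|(a.val : ℝ) - b.val| - C - C)) *
          Real.sqrt (gradSqNorm μ (G a)) * Real.sqrt (gradSqNorm μ (G b)) := by
      intro a b
      refine (hdec ε hε hεε₁ N hN (G a) (G b) a b C C (hGs a) (hGs b) (hGp a) (hGp b) (hGl a)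
        (hGl b) (hG2i a) (hG2i b) (fun x => ⟨(hpart a x).2.2.2.2.1, (hpart a x).2.2.2.2.2.2.1⟩)
        (fun x => ⟨(hpart b x).2.2.2.2.1, (hpart b x).2.2.2.2.2.2.1⟩) (hG0 a) (hG0 b)).trans ?_
      gcongr
      exact le_abs_self Cd
    -- `⟨𝒰_N²⟩ ≤ K₁ ε^{-1/4}` and `⟨𝒢_N²⟩ ≤ K₁`
    have hSU : ∫ z, ((∑ a, U a z) / Real.sqrt N) ^ 2 ∂μ ≤ K₁ * ε ^ (-(1 / 4 : ℝ)) := by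
      have h1 := integral_sq_sum_le μ U hUm (fun a b => |∫ z, U a z * U b z ∂μ|)
        fun a b => le_abs_self _
      have h2 := sum_abs_cov_le μ U (fun a => gradSqNorm μ (U a)) (abs_nonneg Cd) hc
        (D := Real.exp (c * C) * S * (2 * (C * ε ^ (-(1 / 4 : ℝ))))) (by positivity) hcovU hgU
      have e : ∫ z, ((∑ a, U a z) / Real.sqrt N) ^ 2 ∂μ = (∫ z, (∑ a, U a z) ^ 2 ∂μ) / N := by
        simp_rw [div_pow, Real.sq_sqrt hNpos.le]
        rw [integral_div]
      rw [e, div_le_iff₀ hNpos]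
      calc ∫ z, (∑ a, U a z) ^ 2 ∂μ ≤ ∑ a, ∑ b, |∫ z, U a z * U b z ∂μ| := h1
        _ ≤ _ := h2
        _ = K₁ * ε ^ (-(1 / 4 : ℝ)) * N := by simp only [hK₁]; ring
    have hSG : ∫ z, ((∑ a, G a z) / Real.sqrt N) ^ 2 ∂μ ≤ K₁ := by
      have h1 := integral_sq_sum_le μ G hGm (fun a b => |∫ z, G a z * G b z ∂μ|)
        fun a b => le_abs_self _
      have h2 := sum_abs_cov_le μ G (fun a => gradSqNorm μ (G a)) (abs_nonneg Cd) hc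
        (D := Real.exp (c * C) * S * (2 * C)) (by positivity) hcovG hgG
      have e : ∫ z, ((∑ a, G a z) / Real.sqrt N) ^ 2 ∂μ = (∫ z, (∑ a, G a z) ^ 2 ∂μ) / N := by
        simp_rw [div_pow, Real.sq_sqrt hNpos.le]
        rw [integral_div]
      rw [e, div_le_iff₀ hNpos]
      calc ∫ z, (∑ a, G a z) ^ 2 ∂μ ≤ ∑ a, ∑ b, |∫ z, G a z * G b z ∂μ| := h1
        _ ≤ _ := h2
        _ = K₁ * N := by simp only [hK₁]; ring
    exact finiteTimeConductivity_le hS hT hε (hΦ ε N hε) ht hUs hGs hUp hGp hU2i hG2i hid hSU hSG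
  -- the bound tends to `0` as `ε → 0⁺` (here `n - m ≥ 1` is used)
  set B' : ℝ → ℝ := fun ε => 3 / T ^ 2 *
    (2 * K₁ * (ε ^ d * ε ^ (3 / 4 : ℝ)) / t + ε ^ (d + 1) * ε ^ 2 * t * K₁) with hB'
  have hBB' : ∀ ε : ℝ, 0 < ε → B ε = B' ε := by
    intro ε hε
    simp only [hB, hB']
    have e1 : ε ^ (-(m : ℝ)) = (ε ^ m)⁻¹ := by rw [Real.rpow_neg hε.le, Real.rpow_natCast]
    have e2 : ε ^ (-(n : ℝ)) = (ε ^ n)⁻¹ := by rw [Real.rpow_neg hε.le, Real.rpow_natCast]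
    have e3 : ε ^ (3 / 4 : ℝ) = ε * ε ^ (-(1 / 4 : ℝ)) := by
      rw [show (3 / 4 : ℝ) = 1 + -(1 / 4 : ℝ) by norm_num, Real.rpow_add hε, Real.rpow_one]
    have e4pos : 0 < ε ^ (-(1 / 4 : ℝ)) := Real.rpow_pos_of_pos hε _
    rw [e1, e2, e3, hd]
    field_simp
    ring
  have hB't : Tendsto B' (𝓝[>] 0) (𝓝 0) := by
    have hcont : Continuous B' := by
      simp only [hB']
      have h34 : Continuous fun ε : ℝ => ε ^ (3 / 4 : ℝ) :=
        Real.continuous_rpow_const (by norm_num)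
      fun_prop
    have h0 : B' 0 = 0 := by
      simp only [hB']
      rw [Real.zero_rpow (by norm_num), zero_pow (Nat.succ_ne_zero d)]
      simp
    simpa [h0] using (hcont.tendsto 0).mono_left nhdsWithin_le_nhds
  have hBt : Tendsto (fun ε => ENNReal.ofReal (B ε)) (𝓝[>] 0) (𝓝 0) := by
    rw [← ENNReal.ofReal_zero]
    refine ENNReal.tendsto_ofReal (hB't.congr' ?_)
    filter_upwards [self_mem_nhdsWithin] with ε hε
    exact (hBB' ε hε).symm
  -- conclusion
  have hev : ∀ᶠ ε in 𝓝[>] (0 : ℝ),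
      limsup (fun N : ℕ => finiteTimeConductivity γ T ε n m N (Φ ε N) t) (atTop ⊓ 𝓟 {N | Odd N}) ≤
        ENNReal.ofReal (B ε) := by
    filter_upwards [Ioo_mem_nhdsGT (lt_min hε₀ hε₁)] with ε hε
    refine limsup_le_of_le (by isBoundedDefault) ?_
    exact eventually_inf_principal.2 (eventually_atTop.2 ⟨N₀, fun N hN₀ hN => hbound ε hε.1 hε.2 N hN₀ hN⟩)
  refine le_antisymm ?_ bot_le
  calc limsup (fun ε : ℝ => limsup (fun N : ℕ => finiteTimeConductivity γ T ε n m N (Φ ε N) t)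
        (atTop ⊓ 𝓟 {N | Odd N})) (𝓝[>] 0)
      ≤ limsup (fun ε => ENNReal.ofReal (B ε)) (𝓝[>] 0) := limsup_le_limsup hev
    _ = 0 := hBt.limsup_eq

end Literature.Barriers.AtomisticToContinuum

end
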